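import Literature.Topology.FourManifolds.IntrinsicFoldCriterion
import Literature.Topology.FourManifolds.IndefiniteFoldChartTransport
import HarnessLib

/-!
# The `fold` clause at a point of a map between manifolds, from the intrinsic criterion

Topic `Literature/Topology/FourManifolds`.  The manifold form of
`hasIndefiniteFoldChart_of_kerHessian` (`IntrinsicFoldCriterion.lean`): for `f : X → B` from a
4-manifold to a surface (charted on `ℝ⁴`, `ℝ²`), smooth charts `Φ₀` at `p` and `Ψ₀` with
`f (Φ₀.source) ⊆ Ψ₀.source`, and the local representative `G = Ψ₀ ∘ f ∘ Φ₀⁻¹ : ℝ⁴ → ℝ²`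
`C^∞` with `dG ≠ 0` at `y₀ = Φ₀ p`, a covector `ℓ ≠ 0` with `ℓ ∘ dG_{y₀} = 0` and the Hessian
of `ℓ ∘ G` at `y₀` nondegenerate and indefinite on `ker dG_{y₀}` — Levine's definition of an
indefinite fold point, as used by Baykur–Saeki 2017, §2.1 — the point `p` carries the charts
of the clause `IsSimplifiedBrokenLefschetzFibration.fold` (Hayano 2011, Def. 2.1 (4)).
PROVED (composition with `exists_foldChart_of_hasIndefiniteFoldChart`); no named fact.

## References

* R. İ. Baykur, O. Saeki, *Simplifying indefinite fibrations on 4-manifolds*, arXiv:1705.11169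
  (Trans. AMS 376, 2023), §2.1. [BaykurSaeki2017]
* K. Hayano, *On genus-1 simplified broken Lefschetz fibrations*, Algebr. Geom. Topol. 11
  (2011), Def. 2.1 (4). [Hayano2011]
-/

noncomputable section

-- Instance search through the tower `E →L[ℝ] E →L[ℝ] ℝ` needs one more level of pending depth.
set_option maxSynthPendingDepth 2

open Set Function Filter
open scoped Manifold Topology ContDiff

namespace Literature.Topology.FourManifolds

variable {X : Type*} [TopologicalSpace X] [ChartedSpace (EuclideanSpace ℝ (Fin 4)) X]
  {B : Type*} [TopologicalSpace B] [ChartedSpace (EuclideanSpace ℝ (Fin 2)) B]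

/-- **The `fold` clause from the intrinsic criterion, on a manifold.**  Let `f : X → B`, `Φ₀`
a smooth chart of `X` at `p` and `Ψ₀` one of `B` with `f (Φ₀.source) ⊆ Ψ₀.source` (both `C^∞`
with `C^∞` inverses), and suppose the local representative `G = Ψ₀ ∘ f ∘ Φ₀⁻¹` is `C^∞` on
`ℝ⁴` with `dG_{Φ₀ p} ≠ 0`, and for some covector `ℓ ≠ 0` with `ℓ ∘ dG_{Φ₀ p} = 0` the Hessian of
`ℓ ∘ G` at `Φ₀ p` is nondegenerate and indefinite on `ker dG_{Φ₀ p}`.  Then `f` has at `p`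
centred charts `φ'`, `ψ'` with `ψ' (f q) = ((φ' q)₀, (φ' q)₁² + (φ' q)₂² - (φ' q)₃²)` — the
clause `IsSimplifiedBrokenLefschetzFibration.fold` at `p`.  (A representative that is only
smooth near `Φ₀ p` is first cut off; cf. `HasIndefiniteFoldChart.congr_of_eventuallyEq`.)
[cite: BaykurSaeki2017, §2.1] -/
theorem exists_foldChart_of_kerHessian {f : X → B}
    {Φ₀ : OpenPartialHomeomorph X (EuclideanSpace ℝ (Fin 4))}
    {Ψ₀ : OpenPartialHomeomorph B (EuclideanSpace ℝ (Fin 2))}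
    (hΦ₀ : ContMDiffOn (𝓡 4) (𝓡 4) ∞ Φ₀ Φ₀.source)
    (hΦ₀s : ContMDiffOn (𝓡 4) (𝓡 4) ∞ Φ₀.symm Φ₀.target)
    (hΨ₀ : ContMDiffOn (𝓡 2) (𝓡 2) ∞ Ψ₀ Ψ₀.source)
    (hΨ₀s : ContMDiffOn (𝓡 2) (𝓡 2) ∞ Ψ₀.symm Ψ₀.target)
    (hmaps₀ : MapsTo f Φ₀.source Ψ₀.source) {p : X} (hp : p ∈ Φ₀.source)
    {G : EuclideanSpace ℝ (Fin 4) → EuclideanSpace ℝ (Fin 2)} (hG : ContDiff ℝ ∞ G)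
    (hGf : G =ᶠ[𝓝 (Φ₀ p)] (Ψ₀ ∘ f ∘ Φ₀.symm)) (hdG : fderiv ℝ G (Φ₀ p) ≠ 0)
    {ℓ : EuclideanSpace ℝ (Fin 2) →L[ℝ] ℝ} (hℓ : ℓ ≠ 0) (hℓG : ℓ.comp (fderiv ℝ G (Φ₀ p)) = 0)
    (hH : ∀ v : EuclideanSpace ℝ (Fin 4), fderiv ℝ G (Φ₀ p) v = 0 →
      (∀ w : EuclideanSpace ℝ (Fin 4), fderiv ℝ G (Φ₀ p) w = 0 →
        fderiv ℝ (fderiv ℝ (fun q => ℓ (G q))) (Φ₀ p) v w = 0) → v = 0)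
    (hneg : ∃ v : EuclideanSpace ℝ (Fin 4), fderiv ℝ G (Φ₀ p) v = 0 ∧
      fderiv ℝ (fderiv ℝ (fun q => ℓ (G q))) (Φ₀ p) v v < 0)
    (hpos : ∃ w : EuclideanSpace ℝ (Fin 4), fderiv ℝ G (Φ₀ p) w = 0 ∧
      0 < fderiv ℝ (fderiv ℝ (fun q => ℓ (G q))) (Φ₀ p) w w) :
    ∃ (φ' : OpenPartialHomeomorph X (EuclideanSpace ℝ (Fin 4)))
      (ψ' : OpenPartialHomeomorph B (EuclideanSpace ℝ (Fin 2))),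
      p ∈ φ'.source ∧ φ' p = 0 ∧ MapsTo f φ'.source ψ'.source ∧
      ContMDiffOn (𝓡 4) (𝓡 4) ∞ φ' φ'.source ∧ ContMDiffOn (𝓡 4) (𝓡 4) ∞ φ'.symm φ'.target ∧
      ContMDiffOn (𝓡 2) (𝓡 2) ∞ ψ' ψ'.source ∧ ContMDiffOn (𝓡 2) (𝓡 2) ∞ ψ'.symm ψ'.target ∧
      ∀ q ∈ φ'.source, (ψ' (f q)) 0 = (φ' q) 0 ∧
        (ψ' (f q)) 1 = (φ' q) 1 ^ 2 + (φ' q) 2 ^ 2 - (φ' q) 3 ^ 2 :=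
  exists_foldChart_of_hasIndefiniteFoldChart hΦ₀ hΦ₀s hΨ₀ hΨ₀s hmaps₀ hp
    ((hasIndefiniteFoldChart_of_kerHessian hG hdG hℓ hℓG hH hneg hpos).congr_of_eventuallyEq
      hGf)

end Literature.Topology.FourManifolds

end
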